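import Summits.ValiantsHypothesis.ValiantsHypothesis.Theorems.NewtonFramesTwoProductsFrameRungTwoCoverK

/-!
# Crux `TwoProducts` (stmt-5906), line `FrameRungTwo`: the `k = 2` count from the RE-TARGETED shallow-neighbour dichotomy (IX₃)

`…FrameRungTwoShallowNeighbour.lean` (p603280) derives the `k = 2` cross-cancelling count from (IX) = `hIX`: "member depth ≤ 3, OR
a neighbour whose non-member word demotes ≤ 2 letters".  `memo-IX-windows.md` (this line's calibration) shows (IX) is SHARP — at member
depth 3 the shallow neighbour can fail — and records the numerically exact variant with the thresholds moved:

  (IX₃)  member depth ≤ 1, OR `e = Σ w − (T'_p − y)` for a word `w` of the other frame demoting AT MOST THREE letters and a letter `y`.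

(IX₃) holds in every one of ≈ 4·10⁵ enumerated instances from member depth 2 on (1-D faithful model incl. exotic member frames, the
coefficient model and the degenerate-functional model), where (IX) needs depth ≥ 4.  Both disjuncts of (IX₃) put the vertex in the
FOUR-gap family of `…FrameRungTwoCoverK.lean`, so the count follows with exponent 4 instead of 3:

* `crossCancel_of_shallowNeighbour₃` — IF every cross-cancelling vertex satisfies (IX₃) (`hIX₃` for words of `f`, `hIX₃'` for words
  of `g`), THEN the cross-cancelling vertices number `≤ 2 (4(mt)²+7)(mt+1)⁴`.

So the open per-vertex lemma of the `k = 2` layer may be taken to be (IX₃) — a statement with NO depth-4 threshold, true (numerically)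
from depth 2, hence open to induction on the window via the letter sub-instances (memo §4 (S1)) — instead of (IX).  (IX₃) is OPEN.
Honest scope: a CONDITIONAL count for ONE stub of a rung strictly below the crux `TwoProducts`; nothing here bears on `VP ≠ VNP`.
[ours; setting KPTT arXiv:1308.2286 §2, §5]
-/

set_option linter.dupNamespace false

namespace Summit.ValiantsHypothesis.ValiantsHypothesis.Theorems.NewtonFramesTwoProducts.FrameRungTwoTrinomial

open MvPolynomial
open scoped BigOperators Classical
open Summit.ValiantsHypothesis.Theorems.DissociatedFixedK (lexKey lexKey_injective)
open Summit.ValiantsHypothesis.ValiantsHypothesis.Theorems.DissociatedFixedK.Negative (emb emb_injective)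

noncomputable section

section ShallowThree

variable {m : ℕ}

/-- The shallow-neighbour form with a word demoting `≤ 3` letters and one extra letter gap is the top sum minus FOUR optional gaps.
[ours] -/
theorem exists_gapForm_of_neighbour₃ (f : Fin m → MvPolynomial (Fin 2) ℂ) (T w : Fin m → (Fin 2 →₀ ℕ))
    (hw : ∀ j, w j ∈ (f j).support) (hcard : (Finset.univ.filter fun i => w i ≠ T i).card ≤ 3)
    (p : Fin m) (y : Fin 2 →₀ ℕ) (hy : y ∈ (f p).support) :
    ∃ q : Fin 4 → Option (Fin m × (Fin 2 →₀ ℕ)), (∀ i r, q i = some r → r.2 ∈ (f r.1).support) ∧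
      emb (∑ j, w j) - (emb (T p) - emb y) =
        emb (∑ j, T j) - ∑ i, Option.elim (q i) (0 : Fin 2 → ℝ) (fun r => emb (T r.1) - emb r.2) := by
  obtain ⟨q', hq', hE⟩ := exists_gapForm_of_card_le 3 f T w hw hcard
  refine ⟨Fin.snoc q' (some (p, y)), ?_, ?_⟩
  · intro i r hr
    refine Fin.lastCases ?_ (fun i' => ?_) i hr
    · intro h
      rw [Fin.snoc_last] at h
      cases h; exact hy
    · intro h
      rw [Fin.snoc_castSucc] at h
      exact hq' i' r h
  · rw [Fin.sum_univ_castSucc]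
    simp only [Fin.snoc_castSucc, Fin.snoc_last, Option.elim_some]
    rw [hE]
    abel

/-- **The `k = 2` cross-cancelling count from the re-targeted dichotomy (IX₃)** (two dissociated frames, one product each, any `t`,
carries allowed): member depth `≤ 1` or a neighbour whose non-member word demotes `≤ 3` letters. [ours] -/
theorem crossCancel_of_shallowNeighbour₃ (m t : ℕ) (A B : Fin m → Finset (Fin 2 →₀ ℕ))
    (f g : Fin m → MvPolynomial (Fin 2) ℂ)
    (hA : ∀ j, (A j).card ≤ t) (hB : ∀ j, (B j).card ≤ t)
    (hf : ∀ j, (f j).support ⊆ A j) (hg : ∀ j, (g j).support ⊆ B j)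
    (hinjA : ∀ a b : Fin m → (Fin 2 →₀ ℕ), (∀ j, a j ∈ A j) → (∀ j, b j ∈ A j) → ∑ j, a j = ∑ j, b j → a = b)
    (hinjB : ∀ a b : Fin m → (Fin 2 →₀ ℕ), (∀ j, a j ∈ B j) → (∀ j, b j ∈ B j) → ∑ j, a j = ∑ j, b j → a = b)
    (hIX₃ : ∀ (lc : (Fin 2 → ℝ) →L[ℝ] ℝ) (e : Fin 2 →₀ ℕ) (T T' a : Fin m → (Fin 2 →₀ ℕ)),
      (∀ j, T j ∈ (f j).support) → (∀ j, ∀ x ∈ (f j).support, lexKey lc x ≤ lexKey lc (T j)) →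
      (∀ j, T' j ∈ (g j).support) → (∀ j, ∀ x ∈ (g j).support, lexKey lc x ≤ lexKey lc (T' j)) →
      (∀ j, a j ∈ (f j).support) → ∑ j, a j = e →
      (∀ x : Fin 2 →₀ ℕ, x ≠ e → lc (emb e) ≤ lc (emb x) → coeff x (∏ j, f j) + coeff x (∏ j, g j) = 0) →
      coeff e (∏ j, f j) + coeff e (∏ j, g j) ≠ 0 → ∑ j, T j = ∑ j, T' j → lexKey lc e < lexKey lc (∑ j, T j) →
      (Finset.univ.filter fun i => a i ≠ T i).card ≤ 1 ∨
        ∃ (w : Fin m → (Fin 2 →₀ ℕ)) (p : Fin m) (y : Fin 2 →₀ ℕ), (∀ i, w i ∈ (g i).support) ∧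
          (Finset.univ.filter fun i => w i ≠ T' i).card ≤ 3 ∧ y ∈ (g p).support ∧
          emb e = emb (∑ i, w i) - (emb (T' p) - emb y))
    (hIX₃' : ∀ (lc : (Fin 2 → ℝ) →L[ℝ] ℝ) (e : Fin 2 →₀ ℕ) (T' T a : Fin m → (Fin 2 →₀ ℕ)),
      (∀ j, T' j ∈ (g j).support) → (∀ j, ∀ x ∈ (g j).support, lexKey lc x ≤ lexKey lc (T' j)) →
      (∀ j, T j ∈ (f j).support) → (∀ j, ∀ x ∈ (f j).support, lexKey lc x ≤ lexKey lc (T j)) →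
      (∀ j, a j ∈ (g j).support) → ∑ j, a j = e →
      (∀ x : Fin 2 →₀ ℕ, x ≠ e → lc (emb e) ≤ lc (emb x) → coeff x (∏ j, g j) + coeff x (∏ j, f j) = 0) →
      coeff e (∏ j, g j) + coeff e (∏ j, f j) ≠ 0 → ∑ j, T' j = ∑ j, T j → lexKey lc e < lexKey lc (∑ j, T' j) →
      (Finset.univ.filter fun i => a i ≠ T' i).card ≤ 1 ∨
        ∃ (w : Fin m → (Fin 2 →₀ ℕ)) (p : Fin m) (y : Fin 2 →₀ ℕ), (∀ i, w i ∈ (f i).support) ∧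
          (Finset.univ.filter fun i => w i ≠ T i).card ≤ 3 ∧ y ∈ (f p).support ∧
          emb e = emb (∑ i, w i) - (emb (T p) - emb y)) :
    {p : Fin 2 → ℝ | p ∈ Set.extremePoints ℝ (convexHull ℝ
          (emb '' ((∏ j, f j + ∏ j, g j).support : Set (Fin 2 →₀ ℕ)))) ∧
        ∃ l : (Fin 2 → ℝ) →ₗ[ℝ] ℝ,
          (∀ q ∈ emb '' ((∏ j, f j + ∏ j, g j).support : Set (Fin 2 →₀ ℕ)), q ≠ p → l q < l p) ∧
          ∃ q ∈ emb '' ((∏ j, f j).support : Set (Fin 2 →₀ ℕ)) ∪ emb '' ((∏ j, g j).support : Set (Fin 2 →₀ ℕ)),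
            l p < l q}.ncard ≤ 2 * ((4 * (m * t) ^ 2 + 7) * (m * t + 1) ^ 4) := by
  refine crossCancel_of_gapCover 4 m t A B f g hA hB hf hg hinjA hinjB ?_ ?_
  · intro lc e T T' a hT hTmax hT' hTmax' ha hae hzero he htop hTe
    rcases hIX₃ lc e T T' a hT hTmax hT' hTmax' ha hae hzero he htop hTe with hc | ⟨w, p, y, hw, hwc, hy, hE⟩
    · obtain ⟨q, hq, hq'⟩ := exists_gapForm_of_card_le 4 f T a ha (hc.trans (by norm_num))
      exact Or.inl ⟨q, hq, by rw [← hae]; exact hq'⟩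
    · obtain ⟨q, hq, hs⟩ := exists_gapForm_of_neighbour₃ g T' w hw hwc p y hy
      exact Or.inr ⟨q, hq, by rw [hE, hs]⟩
  · intro lc e T' T a hT' hTmax' hT hTmax ha hae hzero he htop hTe
    rcases hIX₃' lc e T' T a hT' hTmax' hT hTmax ha hae hzero he htop hTe with hc | ⟨w, p, y, hw, hwc, hy, hE⟩
    · obtain ⟨q, hq, hq'⟩ := exists_gapForm_of_card_le 4 g T' a ha (hc.trans (by norm_num))
      exact Or.inl ⟨q, hq, by rw [← hae]; exact hq'⟩
    · obtain ⟨q, hq, hs⟩ := exists_gapForm_of_neighbour₃ f T w hw hwc p y hy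
      exact Or.inr ⟨q, hq, by rw [hE, hs]⟩

end ShallowThree

end

end Summit.ValiantsHypothesis.ValiantsHypothesis.Theorems.NewtonFramesTwoProducts.FrameRungTwoTrinomial
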